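import Summits.CriticalPhenomena.PercolationContinuityZ3.Theorems.PercNearOneGluingNoHeavyPcintSignedConfigPeel
import HarnessLib

/-!
# CriticalPhenomena/PercolationContinuityZ3 — Theorems/PercNearOneGluingNoHeavyPcintSignedConfigPeelCount.lean: the GAP RECURSION for the refined arch counts `epCount i S N`

Lane prim-pcint, STRUCTURE rule «numerics ⇒ structure ⇒ conjecture» (prim-pcint-2 GEN 22); sequel of …PcintSignedConfigPeel.  Counting the
next-gap bijection on `Fin N`: the next gap of an arch configuration with `EPfx i` is a block of positions `i+1, …, i+ℓ` (`blk N i ℓ`), whence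
  `epCount i S N = Σ_{ℓ < N−i−1} Σ_{t ≤ |S|} gCount false [] none (S.take t) ℓ · epCount (i+1) (S.drop t) (N − ℓ)`  for `N ≥ i+2`  (`epCount_rec`),
and the all-core base `epCount i S (i+1) = [S = []] · #goodSet (Fin (i+1))` (`epCount_base`).  Together with `epCount 0 = eCount`
(…PcintSignedConfigCore) this determines the arch counts `eCount S N` from the classes `F` and the Touchard–Riordan numbers; the executable
specification numerics/erec.py of the lane checks the recursion against brute force for `N ≤ 7`.

HONEST FRAMING: elementary finite combinatorics.  No `sorry`; standard axioms.  Written by prim-pcint-2 gen 22 (prover-prim-pcint-2-g22-0), 2026-08-27.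
-/

namespace Summit.CriticalPhenomena.PercolationContinuityZ3.Theorems.Pcint.ChordDiag

/-! ### Blocks of positions -/

/-- The block of positions `i+1, …, i+ℓ` of `Fin N`. [folklore] -/
def blk (N i ℓ : ℕ) : Finset (Fin N) := Finset.univ.filter fun x => i < (x : ℕ) ∧ (x : ℕ) < i + 1 + ℓ

/-- Membership in a block, by rank. [folklore] -/
theorem mem_blk {N i ℓ : ℕ} (x : Fin N) : x ∈ blk N i ℓ ↔ i < rank x ∧ rank x < i + 1 + ℓ := by
  simp [blk, rank_fin]

/-- The size of a block. [folklore] -/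
theorem card_blk {N i ℓ : ℕ} (h : i + 1 + ℓ ≤ N) : (blk N i ℓ).card = ℓ := by
  have : (blk N i ℓ).card = (Finset.range ℓ).card := by
    refine Finset.card_bij (fun x _ => (x : ℕ) - (i + 1)) ?_ ?_ ?_
    · intro x hx
      rw [mem_blk, rank_fin] at hx
      rw [Finset.mem_range]; omega
    · intro x hx y hy hxy
      rw [mem_blk, rank_fin] at hx hy
      exact Fin.ext (by omega)
    · intro j hj
      rw [Finset.mem_range] at hj
      refine ⟨⟨i + 1 + j, by omega⟩, ?_, by simp⟩
      rw [mem_blk, rank_fin]; simp; omega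
  rwa [Finset.card_range] at this

/-! ### The gap recursion -/

/-- The next gap of an arch configuration on `Fin N` with `EPfx i` is a block `blk N i ℓ`, `ℓ < N − i − 1`. [folklore] -/
theorem ngap_eq_blk {N i : ℕ} {S : List Bool} {c : Cfg (Fin N)} (hc : IsECfg S c) (hN : i + 2 ≤ N) :
    ∃ ℓ, ℓ < N - i - 1 ∧ ngap c i = blk N i ℓ := by
  obtain ⟨k, hk, hik, hmin⟩ := exists_next_core hc.1 hc.2.2.1 (by rw [Fintype.card_fin]; exact hN)
  have hkN : rank k < N := by rw [rank_fin]; exact k.2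
  refine ⟨rank k - i - 1, by omega, ?_⟩
  ext x
  rw [mem_ngap_iff_lt hk hik hmin, mem_blk, show x < k ↔ rank x < rank k from
    ⟨rank_lt_rank, fun h => lt_of_not_ge fun h' => absurd h (not_lt.2 (rank_le_rank h'))⟩]
  constructor
  · rintro ⟨h1, h2⟩; exact ⟨h1, by omega⟩
  · rintro ⟨h1, h2⟩; exact ⟨h1, by omega⟩

/-- **The gap recursion**: for `N ≥ i+2`,
`epCount i S N = Σ_{ℓ < N−i−1} Σ_{t ≤ |S|} gCount false [] none (S.take t) ℓ · epCount (i+1) (S.drop t) (N − ℓ)`. [folklore] -/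
theorem epCount_rec (i : ℕ) (S : List Bool) (N : ℕ) (hN : i + 2 ≤ N) :
    epCount i S N = ∑ ℓ ∈ Finset.range (N - i - 1), ∑ t ∈ Finset.range (S.length + 1),
      gCount false [] none (S.take t) ℓ * epCount (i + 1) (S.drop t) (N - ℓ) := by
  classical
  unfold epCount
  -- sort by the next gap, a block
  rw [Finset.card_eq_sum_card_fiberwise (f := fun c : Cfg (Fin N) => ngap c i) (t := (Finset.range (N - i - 1)).image (blk N i))]
  · rw [Finset.sum_image]
    · refine Finset.sum_congr rfl fun ℓ hℓ => ?_
      rw [Finset.mem_range] at hℓ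
      set G := blk N i ℓ with hGdef
      have hGmem : ∀ x, x ∈ G ↔ i < rank x ∧ rank x < i + 1 + ℓ := fun x => mem_blk x
      have hcard : G.card = ℓ := card_blk (by omega)
      have hcardc : (Gᶜ).card = N - ℓ := by rw [Finset.card_compl, Fintype.card_fin, hcard]
      -- sort the fibre by the number `t` of letters in the gap
      rw [Finset.card_eq_sum_card_fiberwise (f := fun c : Cfg (Fin N) => (sw (resC c G)).length)
        (t := Finset.range (S.length + 1))]
      · refine Finset.sum_congr rfl fun t ht => ?_
        rw [Finset.mem_range] at ht
        have e1 : (gSet false [] none (S.take t) ↥G).card = gCount false [] none (S.take t) ℓ := by rw [card_gSet_coe, hcard]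
        have e2 : (epSet (i + 1) (S.drop t) ↥(Gᶜ)).card = (epSet (i + 1) (S.drop t) (Fin (N - ℓ))).card := by
          rw [card_epSet_coe, hcardc]; rfl
        rw [← e1, ← e2, ← Finset.card_product]
        refine Finset.card_nbij' (fun c => (resC c G, resC c Gᶜ)) (fun p => glueC G p.2 p.1) ?_ ?_ ?_ ?_
        · intro c hc
          rw [Finset.mem_coe, Finset.mem_filter, Finset.mem_filter] at hc
          obtain ⟨⟨hc, hG⟩, hk⟩ := hc
          rw [mem_epSet] at hc
          obtain ⟨hgap, hrest, -⟩ := peel_mem hc.1 hc.2 (by rw [Fintype.card_fin]; exact hN) hG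
          rw [hk] at hgap hrest
          rw [Finset.mem_coe, Finset.mem_product, mem_gSet, mem_epSet]
          exact ⟨hgap, hrest⟩
        · rintro ⟨gc, rest⟩ hp
          rw [Finset.mem_coe, Finset.mem_product, mem_gSet, mem_epSet] at hp
          obtain ⟨hE, hpfx, hgap⟩ := unpeel_mem (i := i) (ℓ := ℓ) (by rw [Fintype.card_fin]; omega) hGmem hp.1 hp.2.1 hp.2.2
          rw [List.take_append_drop] at hE
          rw [Finset.mem_coe, Finset.mem_filter, Finset.mem_filter]
          refine ⟨⟨mem_epSet.2 ⟨hE, hpfx⟩, hgap⟩, ?_⟩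
          rw [resC_glueC_right, hp.1.2.1, List.length_take, min_eq_left (by omega)]
        · intro c hc
          rw [Finset.mem_coe, Finset.mem_filter, Finset.mem_filter] at hc
          obtain ⟨⟨hc, hG⟩, -⟩ := hc
          rw [mem_epSet] at hc
          have hcl : Closed c.1 G := hG ▸ closed_ngap hc.2
          exact glueC_resC hc.1.1 hcl
        · rintro ⟨gc, rest⟩ -
          exact Prod.ext resC_glueC_right resC_glueC_left
      · intro c hc
        rw [Finset.mem_coe, Finset.mem_filter] at hc
        obtain ⟨hc, hG⟩ := hc
        rw [mem_epSet] at hc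
        rw [Finset.mem_coe, Finset.mem_range, Nat.lt_succ_iff]
        show (sw (resC c G)).length ≤ S.length
        have hcl : Closed c.1 G := hG ▸ closed_ngap hc.2
        have := length_sw_resC_le hcl
        rw [hc.1.2.1] at this
        exact this
    · -- `blk N i` is injective on `ℓ < N − i − 1` (sizes)
      intro ℓ₁ h₁ ℓ₂ h₂ h
      rw [Finset.mem_coe, Finset.mem_range] at h₁ h₂
      have := congrArg Finset.card h
      rwa [card_blk (by omega), card_blk (by omega)] at this
  · intro c hc
    rw [Finset.mem_coe, mem_epSet] at hc
    obtain ⟨ℓ, hℓ, hG⟩ := ngap_eq_blk hc.1 hN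
    rw [Finset.mem_coe, Finset.mem_image]
    exact ⟨ℓ, Finset.mem_range.2 hℓ, hG.symm⟩

/-- **The all-core base**: on `i+1` points, `EPfx i` makes every point a core point, so the configuration is a letter-free irreducible chord
diagram: `epCount i S (i+1) = [S = []] · #goodSet (Fin (i+1))`. [folklore] -/
theorem epCount_base (i : ℕ) (S : List Bool) : epCount i S (i + 1) = if S = [] then (goodSet (Fin (i + 1))).card else 0 := by
  classical
  unfold epCount
  -- every point is a core point, hence not a letter
  have hall : ∀ c ∈ epSet i S (Fin (i + 1)), ∀ x, x ∈ core c := fun c hc x =>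
    (mem_epSet.1 hc).2 x (by rw [rank_fin]; omega)
  have hsw : ∀ c ∈ epSet i S (Fin (i + 1)), sw c = [] := fun c hc => by
    have hI := (mem_epSet.1 hc).1.2.2.1
    rw [← List.length_eq_zero_iff, length_sw, Finset.card_eq_zero, Finset.eq_empty_iff_forall_notMem]
    intro x hx
    exact not_letter_of_mem_core hI (hall c hc x) (mem_letters.1 hx)
  split_ifs with hS
  · subst hS
    refine Finset.card_nbij' (fun c => c.1) (fun π => (π, fun _ => false)) ?_ ?_ ?_ ?_
    · intro c hc
      rw [Finset.mem_coe] at hc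
      have hc' := mem_epSet.1 hc
      rw [Finset.mem_coe, mem_goodSet]
      refine ⟨fun t => ⟨hc'.1.1.1 t, not_letter_of_mem_core hc'.1.2.2.1 (hall c hc t)⟩, fun I hcv hcl => ?_⟩
      by_cases hne : I.Nonempty
      · obtain ⟨x, hx⟩ := hne
        exact Or.inr (mem_core.1 (hall c hc x) I hx hcv hcl)
      · exact Or.inl (Finset.not_nonempty_iff_eq_empty.1 hne)
    · intro π hπ
      rw [Finset.mem_coe, mem_goodSet] at hπ
      rw [Finset.mem_coe, mem_epSet]
      have hblk : ∀ I : Finset (Fin (i + 1)), I.Nonempty → Convex I → Closed π I → I = Finset.univ := fun I hne hcv hcl =>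
        (hπ.2 I hcv hcl).resolve_left (Finset.nonempty_iff_ne_empty.1 hne)
      refine ⟨⟨⟨fun t => (hπ.1 t).1, fun _ _ => rfl⟩, ?_, ⟨⟨0, (hπ.1 0).2⟩, fun I hne hini hcl => hblk I hne hini.convex hcl⟩,
        fun I hne hnu hcv hcl => absurd (hblk I hne hcv hcl) hnu⟩, fun x _ => mem_core.2 fun J hx hcv hcl => hblk J ⟨x, hx⟩ hcv hcl⟩
      -- no letters
      unfold sw
      have : letters ((π, fun _ => false) : Cfg (Fin (i + 1))) = ∅ :=
        Finset.eq_empty_iff_forall_notMem.2 fun t ht => (hπ.1 t).2 (mem_letters.1 ht)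
      rw [this, Finset.sort_empty]; rfl
    · intro c hc
      rw [Finset.mem_coe] at hc
      have hc' := (mem_epSet.1 hc).1.1
      refine Prod.ext rfl (funext fun t => ?_)
      exact (hc'.2 t (not_letter_of_mem_core (mem_epSet.1 hc).1.2.2.1 (hall c hc t))).symm ▸ rfl
    · intro π _; rfl
  · rw [Finset.card_eq_zero, Finset.eq_empty_iff_forall_notMem]
    intro c hc
    exact hS ((mem_epSet.1 hc).1.2.1.symm.trans (hsw c hc))

end Summit.CriticalPhenomena.PercolationContinuityZ3.Theorems.Pcint.ChordDiag
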